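import Summits.QuantumFields.YangMills.Theorems.UnitScaleTiltProp7QkLocalGaugeComparisonBlockSet
import Summits.QuantumFields.YangMills.Theorems.UnitScaleTiltProp7BlockDistanceWeights
import Summits.QuantumFields.YangMills.Theorems.UnitScaleTiltProp7OneStrokeSplit
import Literature.MathematicalPhysics.QuantumFieldTheory.Balaban1983to89.B13BondAveragingReadingNumerals
import Literature.MathematicalPhysics.QuantumFieldTheory.Balaban1983to89.B3Taylor310LocalRemainder
import HarnessLib

/-!
# Route `UnitScaleTilt`, crux «MinimiserStabilityRegPr» (stmt-QuantumFields-19200, stub EX), γ-row `hGF[Lift]` (LOD line, Step I.2) — ★★ THE CUBE-GAUGE FAMILY FOR THE LOD CUBES: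
# for a centre `c` the axial gauge `σ_c := axialT U₀ c` BASED AT `c` makes `U₀^{σ_c}` `2a₀·|x − c|₁`-flat at every non-wrapping bond `⟨x, μ⟩` when the plaquettes of `U₀` are within
# `a₀` of `1`; hence ONE `δ_c` discharging (L5a)'s `hVplaq`, (L5b)'s `hVbond` and (L5c)'s block-set letter (`hax`, `hS`) for every field supported within `|· − c|₁ ≤ R₀`

Cell `ym3-torus` (rung R3 — YM₃ on T³; NOT d = 4, NOT the Clay problem).  Width seat `ym-routeR-w4` g26 (CLAIM «MINE (L6-σ)» 2026-08-30 02:05Z, first refusal routeR-w3 g12).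
THEOREMS ONLY (0 `def`, 0 `sorry`); `--supports stmt-QuantumFields-19200 --as helper`; count-neutral.

THE POINT.  ✓`Prop7LocalComparisonKnit.localComparison_of_cube` (the per-cube (L6) comparison) takes ONE `SU(2)` gauge `σ` and the flatness rows `hVplaq` (bonds adjacent to the
plaquettes of `supp X`), `hVbond` (bonds of `supp X`) and — through `hKrow` := ✓`Prop7QkLocalGaugeComparisonBlockSet.normSq_Qk_one_conj_le_of_blockSet` — the block-set letter
`hax`∕`hS` of (L5c).  Print takes `σ` = the axial gauge of a cube `□̃_j ⊇ □_j` ([Balaban1985RegularSpaces] Lemma 1: `|U^σ(b) − 1| ≤ |x − y|₁·a₀`).  The tree's engine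
✓`Prop7AxialGaugeSup.dist1_mul_inv_le_of_axial` is exactly that, for the axial gauge based at ANY site `y` and any non-wrapping bond; based at the CENTRE `c` of the cut-off
(not at a block corner) no cube boundary enters at all:
* §1 ★ `norm_gaugeAct_axialT_sub_one_le`: `PlaqSmall a₀ U` ⟹ `‖U^{axialT U c}(⟨x, μ⟩) − 1‖ ≤ 2a₀·tdist(c, x)` whenever `2·(tdist(c,x) + 1) ≤ sitesPerDir 0` (`l1 (rel c x) = tdist c x`;
  the trivial field as the comparison background; `dist1 = ‖· − 1‖` on `SU(2)`).
* §2 ★ `norm_gaugeAct_axialT_sub_one_le_of_mem_blockSet`: the (L5c) block-set letter `hax` for `S_c(R) := {Y | ∃ x, B^k(x) = Y ∧ tdist(c, x) ≤ R}` with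
  `δ = 2a₀(R + d(L^k − 1))` (a bond whose source block meets the `R`-ball is within `R + d(L^k − 1)` of `c`, ✓`tdist_le_of_iterBlockOf_eq`).
* §3 ★ SUPPORT ROWS for a field `X` with `X b ≠ 0 → tdist(c, b₋) ≤ R₀`: `hVbond` (`2a₀R₀`), `hVplaq` (`2a₀(R₀ + 1)`), and `hS` of ✓p755950 with `R := R₀ + (d+1)L^k` (the blocks
  `B(b₋)`, `B(b₋) ± e_μ` contain `b₋`, resp. the corners of `B(b₋) ± e_μ`, all within `R₀ + (d+1)L^k` of `c`: ✓`tdist_runSite_le`, ✓`fibreSite_runSite`, ✓`iterBlockOf_fibreSite`);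
  all three monotone in `δ`, so ONE `δ_c := 2a₀(R₀ + (2d+1)L^k)` serves.
* §4 ★★★ AT THE MEMBER (`k = K − n`, `a₀ = regThreshold F n K ε₀ = ε₀η²` from `RegPr`, `d = 3`): the fully DISCHARGED (L5c) third
  `normSq_Qk_one_conj_le_cubeGauge`: for every centre `c`, every `A` with `A b ≠ 0 → tdist(c, b₋) ≤ R₀` and `2(R₀ + 8ℓ + 1) ≤ sitesPerDir 0`,
  `‖Q_k(1)(Ad_{σ_c}A)~‖² ≤ (1+θ)‖Q_k(U₀)Ã‖² + (1+θ⁻¹)·4·(3·10¹⁰L¹⁰ε₀² + 192(ℓδ_c)²)·(cB∕(c₀ℓ^d))·‖Ã‖²`, `δ_c = 2·regThreshold·(R₀ + 7ℓ)` — with px17's cut-off support `R₀ = 3L^sℓ`: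
  `ℓδ_c = 2(3L^s + 7)ε₀` (K-free, |T³|-free); and the matching `hVbond_cubeGauge`, `hVplaq_cubeGauge` with the SAME `δ_c`; `tdist_le_of_hsupp` reads px17's
  support clause (`χ c x ≠ 0 → ∀ κ, min … < L^sℓ`) as `R₀ = 3L^sℓ` for `X := χ_c•A`.
HONEST SCOPE.  Lattice bookkeeping over the tree's axial-gauge engine; the cut-off family, `hloc`, `hP1abs`, the ∀-fold, `hT`, `hGF`, the print rows, `hThm2S`, EX and the crux are NOT
proved here.
References: T. Bałaban, CMP **99** (1985) 75–102 [Balaban1985RegularSpaces] (Lemma 1 (1.24)–(1.25) p.79); CMP **98** (1985) 17–51 [Balaban1985Averaging] ((8)–(9) pp.18–19, pp.24–25);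
CMP **102** (1985) 277–309 [Balaban1985Variational] ((2) p.278); CMP **99** (1985) 389–434 [Balaban1985BackgroundPropagators] ((3.13)–(3.16) p.393, (3.100) pp.413–414).
-/

set_option autoImplicit false

noncomputable section

open scoped BigOperators Matrix.Norms.L2Operator Matrix

namespace Summit.QuantumFields.YangMills.Theorems.Prop7LODCubeGaugeFamily

open Literature.MathematicalPhysics.QuantumFieldTheory.Balaban1983to89
open Literature.MathematicalPhysics.QuantumFieldTheory.Balaban1983to89.T3ContinuumYM3Torus
open Finset T4Continuum BlockAveraging LatticeFieldCalculus B1RG242Torus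
open B5Eq118OneStroke (iterBlockOf)
open B7Prop1Explicit (l1)
open B10Eq27TorusAxialLog (axialT holT rel rel_apply gaugeActT gaugeActT_eq_gaugeAct holT_one)
open B11Eq103H1Complex (BondL2K)
open B3Taylor310LocalRemainder (tdist_comm tdist_triangle tdist_eq_sum_natAbs)
open B13BondAveragingReadingNumerals (tdist_runSite_le)
open T3LevelShift (bondShift)
open T3PrintedRegularOrbits (sites_eq)
open T3PrintedRegularMinimiser (RegPr)
open T3RegularMinimiser (regThreshold regThreshold_pos)
open T3SectALandauChart (eta)
open Summit.QuantumFields.YangMills.Theorems.Prop7SectET3HilbertLetters (toL2 toL2B)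
open Summit.QuantumFields.YangMills.Theorems.Prop7SectET3CurvedPropagators (Qk)
open Summit.QuantumFields.YangMills.Theorems.Prop7AxialGaugeSup (dist1_mul_inv_le_of_axial)
open Summit.QuantumFields.YangMills.Theorems.IterPlaqSmallAllL (axialT_gaugeActT_axialT plaqSmall_gaugeActT)
open Summit.QuantumFields.YangMills.Theorems.Prop7CombGauge (iterBlockOf_fibreSite)
open Summit.QuantumFields.YangMills.Theorems.Prop7FlatCoercivity (fibreSite_runSite)
open Summit.QuantumFields.YangMills.Theorems.Prop7BlockDistanceWeights (tdist_le_of_iterBlockOf_eq tdist_src_tgt_le_one)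
open Summit.QuantumFields.YangMills.Theorems.Prop7QkLocalGaugeComparisonBlockSet (normSq_Qk_one_conj_le_of_blockSet)

/-! ## §1 The axial gauge based at a centre: per-bond flatness from small plaquettes -/

section PerBond

variable {P : Params}

/-- `|x − c|₁ = tdist(c, x)`: the `ℓ¹` length of the minimal relative position is the torus distance. [folklore] -/
theorem l1_rel_eq_tdist (c x : Site P 0) : l1 (rel c x) = Site.tdist c x := by
  rw [tdist_comm, tdist_eq_sum_natAbs]
  rfl

/-- ★ **[B6] LEMMA 1 FOR THE AXIAL GAUGE BASED AT A CENTRE**: if every plaquette variable of `U` is within `a₀` of `1`, the gauged field `U^{axialT U c}` satisfies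
`‖U^σ(⟨x, μ⟩) − 1‖ ≤ 2a₀·tdist(c, x)` at every bond not wrapping the torus as seen from `c` (`(rel c x μ + 1)·2 ≤ N₀`).  (✓`dist1_mul_inv_le_of_axial` against the trivial field.)
[cite: Balaban1985RegularSpaces, Lemma 1 (1.25) p.79; Balaban1985Averaging, pp.24-25] -/
theorem norm_gaugeAct_axialT_sub_one_le (U : GaugeField P 0 (Matrix.specialUnitaryGroup (Fin 2) ℂ)) {a₀ : ℝ} (ha₀ : 0 < a₀) (hU : PlaqSmall a₀ U)
    (c : Site P 0) (b : PBond P 0) (hwrap : (rel c b.src b.dir + 1) * 2 ≤ (P.sitesPerDir 0 : ℤ)) :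
    ‖((GaugeField.gaugeAct (axialT U c) U b : Matrix.specialUnitaryGroup (Fin 2) ℂ) : Matrix (Fin 2) (Fin 2) ℂ) - 1‖ ≤ 2 * a₀ * (Site.tdist c b.src : ℝ) := by
  set W : GaugeField P 0 (Matrix.specialUnitaryGroup (Fin 2) ℂ) := gaugeActT (axialT U c) U with hW
  have hWs : PlaqSmall a₀ W := plaqSmall_gaugeActT _ hU
  have h1s : PlaqSmall a₀ (fun _ : PBond P 0 => (1 : Matrix.specialUnitaryGroup (Fin 2) ℂ)) := fun p => by
    simp only [GaugeField.plaqHol, mul_one, inv_one, GaugeGroup.dist1_one]; exact ha₀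
  obtain ⟨x, μ⟩ := b
  have hax : axialT W c x = axialT (fun _ : PBond P 0 => (1 : Matrix.specialUnitaryGroup (Fin 2) ℂ)) c x := by
    rw [hW, axialT_gaugeActT_axialT]; unfold axialT; rw [holT_one]
  have hax' : axialT W c (x.shift μ) = axialT (fun _ : PBond P 0 => (1 : Matrix.specialUnitaryGroup (Fin 2) ℂ)) c (x.shift μ) := by
    rw [hW, axialT_gaugeActT_axialT]; unfold axialT; rw [holT_one]
  have h := dist1_mul_inv_le_of_axial W (fun _ : PBond P 0 => (1 : Matrix.specialUnitaryGroup (Fin 2) ℂ)) ha₀.le ha₀.le hWs h1s c x μ hwrap hax hax'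
  simp only [inv_one, mul_one] at h
  rw [SU2Mean.dist1_eq_norm, l1_rel_eq_tdist] at h
  rw [← gaugeActT_eq_gaugeAct, ← hW]
  linarith

/-- The same with the distance bounded by `R` and the no-wrap condition read from `R`: `tdist(c, x) ≤ R`, `2(R + 1) ≤ N₀` ⟹ `‖U^σ(b) − 1‖ ≤ 2a₀R`.
[cite: Balaban1985RegularSpaces, Lemma 1 (1.25) p.79] -/
theorem norm_gaugeAct_axialT_sub_one_le_of_tdist (U : GaugeField P 0 (Matrix.specialUnitaryGroup (Fin 2) ℂ)) {a₀ : ℝ} (ha₀ : 0 < a₀) (hU : PlaqSmall a₀ U)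
    (c : Site P 0) (b : PBond P 0) {R : ℕ} (hR : Site.tdist c b.src ≤ R) (hwrapR : 2 * (R + 1) ≤ P.sitesPerDir 0) :
    ‖((GaugeField.gaugeAct (axialT U c) U b : Matrix.specialUnitaryGroup (Fin 2) ℂ) : Matrix (Fin 2) (Fin 2) ℂ) - 1‖ ≤ 2 * a₀ * (R : ℝ) := by
  -- no wrap: `rel c x μ ≤ |rel c x μ| ≤ |x − c|₁ = tdist ≤ R`
  have hl1 : (rel c b.src b.dir).natAbs ≤ Site.tdist c b.src := by
    rw [← l1_rel_eq_tdist]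
    exact Finset.single_le_sum (f := fun κ => (rel c b.src κ).natAbs) (fun _ _ => Nat.zero_le _) (Finset.mem_univ b.dir)
  have hwrap : (rel c b.src b.dir + 1) * 2 ≤ (P.sitesPerDir 0 : ℤ) := by
    have h1 : rel c b.src b.dir ≤ (R : ℤ) := by
      have : rel c b.src b.dir ≤ ((rel c b.src b.dir).natAbs : ℤ) := Int.le_natAbs
      omega
    have h2 : (2 * (R + 1) : ℤ) ≤ (P.sitesPerDir 0 : ℤ) := by exact_mod_cast hwrapR
    linarith
  have h := norm_gaugeAct_axialT_sub_one_le U ha₀ hU c b hwrap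
  have hR' : (Site.tdist c b.src : ℝ) ≤ R := by exact_mod_cast hR
  nlinarith [hR', ha₀.le]

end PerBond

/-! ## §2 The (L5c) block-set letter for the `R`-ball of blocks around the centre -/

section BlockSet

variable {P : Params} {k : ℕ}

/-- ★ **THE BLOCK-SET ROW `hax`**: for `S_c(R) = {Y | ∃ x, B^k(x) = Y ∧ tdist(c, x) ≤ R}`, every fine bond whose source block lies in `S_c(R)` satisfies
`‖U^{σ_c}(b) − 1‖ ≤ 2a₀·(R + d(L^k − 1))` (the bond source is within `d(L^k − 1)` of a point of the ball, ✓`tdist_le_of_iterBlockOf_eq`), provided `2(R + dL^k + 1) ≤ N₀`.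
[cite: Balaban1985RegularSpaces, Lemma 1 (1.25) p.79; Balaban1984PropagatorsI, (1.6) p.18] -/
theorem norm_gaugeAct_axialT_sub_one_le_of_mem_blockSet (hk : k ≤ P.m + P.K) (U : GaugeField P 0 (Matrix.specialUnitaryGroup (Fin 2) ℂ)) {a₀ : ℝ} (ha₀ : 0 < a₀) (hU : PlaqSmall a₀ U)
    (c : Site P 0) {R : ℕ} (hwrapR : 2 * (R + P.d * P.L ^ k + 1) ≤ P.sitesPerDir 0) :
    ∀ b : PBond P 0, iterBlockOf k b.src ∈ {Y : Site P k | ∃ x : Site P 0, iterBlockOf k x = Y ∧ Site.tdist c x ≤ R} → iterBlockOf k b.tgt ∈ {Y : Site P k | ∃ x : Site P 0, iterBlockOf k x = Y ∧ Site.tdist c x ≤ R} →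
      ‖((GaugeField.gaugeAct (axialT U c) U b : Matrix.specialUnitaryGroup (Fin 2) ℂ) : Matrix (Fin 2) (Fin 2) ℂ) - 1‖ ≤ 2 * a₀ * ((R : ℝ) + (P.d : ℝ) * ((P.L : ℝ) ^ k - 1)) := by
  intro b hb _
  obtain ⟨x, hx, hxR⟩ := hb
  have hL1 : 1 ≤ P.L ^ k := Nat.one_le_pow _ _ P.L_pos
  -- `tdist(c, b₋) ≤ R + d(L^k − 1)`
  have hd : Site.tdist c b.src ≤ R + P.d * (P.L ^ k - 1) :=
    (tdist_triangle c x b.src).trans (Nat.add_le_add hxR (tdist_le_of_iterBlockOf_eq hk hx))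
  have hwrap' : 2 * (R + P.d * (P.L ^ k - 1) + 1) ≤ P.sitesPerDir 0 := by
    have : P.d * (P.L ^ k - 1) ≤ P.d * P.L ^ k := Nat.mul_le_mul_left _ (Nat.sub_le _ _)
    omega
  have h := norm_gaugeAct_axialT_sub_one_le_of_tdist U ha₀ hU c b hd hwrap'
  have hcast : (((R + P.d * (P.L ^ k - 1) : ℕ)) : ℝ) = (R : ℝ) + (P.d : ℝ) * ((P.L : ℝ) ^ k - 1) := by
    rw [Nat.cast_add, Nat.cast_mul, Nat.cast_sub hL1, Nat.cast_pow, Nat.cast_one]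
  rw [hcast] at h
  exact h

end BlockSet

/-! ## §3 Support rows: one radius `R₀` around the centre gives `hVbond`, `hVplaq` and the block-set `hS` -/

section Support

variable {P : Params} {k : ℕ}

/-- ★ (L5b)'s `hVbond` from the support radius: `X b ≠ 0 → tdist(c, b₋) ≤ R₀` ⟹ `‖U^{σ_c}(b) − 1‖ ≤ 2a₀R₀` on `supp X` (`2(R₀ + 1) ≤ N₀`). [cite: Balaban1985RegularSpaces, Lemma 1 (1.25) p.79] -/
theorem hVbond_of_tdist (U : GaugeField P 0 (Matrix.specialUnitaryGroup (Fin 2) ℂ)) {a₀ : ℝ} (ha₀ : 0 < a₀) (hU : PlaqSmall a₀ U) (c : Site P 0)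
    (X : PBond P 0 → Matrix (Fin 2) (Fin 2) ℂ) {R₀ : ℕ} (hX : ∀ b, X b ≠ 0 → Site.tdist c b.src ≤ R₀) (hwrap : 2 * (R₀ + 1) ≤ P.sitesPerDir 0) :
    ∀ b : PBond P 0, X b ≠ 0 → ‖((GaugeField.gaugeAct (axialT U c) U b : Matrix.specialUnitaryGroup (Fin 2) ℂ) : Matrix (Fin 2) (Fin 2) ℂ) - 1‖ ≤ 2 * a₀ * (R₀ : ℝ) :=
  fun b hb => norm_gaugeAct_axialT_sub_one_le_of_tdist U ha₀ hU c b (hX b hb) hwrap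

/-- ★ (L5a)'s `hVplaq` from the support radius: the bonds `⟨x, μ⟩` with `X ⟨x + e_μ, ν⟩ ≠ 0` are within `R₀ + 1` of `c`, hence `2a₀(R₀ + 1)`-flat (`2(R₀ + 2) ≤ N₀`).
[cite: Balaban1985RegularSpaces, Lemma 1 (1.25) p.79] -/
theorem hVplaq_of_tdist (U : GaugeField P 0 (Matrix.specialUnitaryGroup (Fin 2) ℂ)) {a₀ : ℝ} (ha₀ : 0 < a₀) (hU : PlaqSmall a₀ U) (c : Site P 0)
    (X : PBond P 0 → Matrix (Fin 2) (Fin 2) ℂ) {R₀ : ℕ} (hX : ∀ b, X b ≠ 0 → Site.tdist c b.src ≤ R₀) (hwrap : 2 * (R₀ + 2) ≤ P.sitesPerDir 0) :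
    ∀ (x : Site P 0) (μ ν : Fin P.d), μ ≠ ν → X ⟨x.shift μ, ν⟩ ≠ 0 →
      ‖((GaugeField.gaugeAct (axialT U c) U ⟨x, μ⟩ : Matrix.specialUnitaryGroup (Fin 2) ℂ) : Matrix (Fin 2) (Fin 2) ℂ) - 1‖ ≤ 2 * a₀ * ((R₀ : ℝ) + 1) := by
  intro x μ ν _ hne
  have h1 : Site.tdist c (x.shift μ) ≤ R₀ := hX ⟨x.shift μ, ν⟩ hne
  have h2 : Site.tdist (x.shift μ) x ≤ 1 := by rw [tdist_comm]; exact tdist_src_tgt_le_one (⟨x, μ⟩ : PBond P 0)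
  have hd : Site.tdist c x ≤ R₀ + 1 := (tdist_triangle c (x.shift μ) x).trans (Nat.add_le_add h1 h2)
  have h := norm_gaugeAct_axialT_sub_one_le_of_tdist U ha₀ hU c ⟨x, μ⟩ hd (by omega)
  push_cast at h
  exact h

/-- ★ **THE BLOCK-SET `hS` OF ✓p755950 FROM THE SUPPORT RADIUS**: for `X b ≠ 0 → tdist(c, b₋) ≤ R₀`, the blocks `B(b₋)`, `B(b₋) − e_{μ(b)}`, `B(b₋) + e_{μ(b)}` of a live bond all meet
the ball of radius `R₀ + (d+1)L^k` (witnesses: `b₋` and the corners of the two neighbours). [cite: Balaban1984PropagatorsI, (1.6) p.18, (1.18) p.20] -/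
theorem hS_of_tdist (hk : k ≤ P.m + P.K) (c : Site P 0) (X : PBond P 0 → Matrix (Fin 2) (Fin 2) ℂ) {R₀ : ℕ} (hX : ∀ b, X b ≠ 0 → Site.tdist c b.src ≤ R₀) :
    ∀ b : PBond P 0, X b ≠ 0 → ∀ Y : Site P k,
      (Y = iterBlockOf k b.src ∨ Y.shift b.dir = iterBlockOf k b.src ∨ Y = (iterBlockOf k b.src).shift b.dir) →
        Y ∈ {Y : Site P k | ∃ x : Site P 0, iterBlockOf k x = Y ∧ Site.tdist c x ≤ R₀ + (P.d + 1) * P.L ^ k} := by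
  have h : P.sitesPerDir 0 = P.L ^ k * P.sitesPerDir k := by
    have := sitesPerDir_zero_eq P k; rwa [lvl_of_le P hk] at this
  intro b hb Y hY
  have h0 := hX b hb
  -- the corner of a block is within `d(L^k − 1)` of each of its points, and adjacent corners are `L^k` apart
  have hcorner : ∀ Y' : Site P k, iterBlockOf k (Site.fibreSite 0 k (Y') fun _ => (⟨0, pow_pos P.L_pos k⟩ : Fin (P.L ^ k))) = Y' := fun Y' => iterBlockOf_fibreSite hk h Y' _
  have hadj : ∀ (Y' : Site P k) (μ : Fin P.d), Site.tdist (Site.fibreSite 0 k (Y') fun _ => (⟨0, pow_pos P.L_pos k⟩ : Fin (P.L ^ k))) (Site.fibreSite 0 k (Y'.shift μ) fun _ => (⟨0, pow_pos P.L_pos k⟩ : Fin (P.L ^ k))) ≤ P.L ^ k := by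
    intro Y' μ
    have hrs : Y'.shift μ = runSite Y' μ 1 := by rw [runSite_succ, runSite_zero]
    rw [hrs, fibreSite_runSite h Y' μ 1, one_mul]
    exact tdist_runSite_le _ _ _
  have hblk : Site.tdist b.src (Site.fibreSite 0 k (iterBlockOf k b.src) fun _ => (⟨0, pow_pos P.L_pos k⟩ : Fin (P.L ^ k))) ≤ P.d * (P.L ^ k - 1) :=
    tdist_le_of_iterBlockOf_eq hk (by rw [hcorner])
  have hdk : P.d * (P.L ^ k - 1) ≤ P.d * P.L ^ k := Nat.mul_le_mul_left _ (Nat.sub_le _ _)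
  rcases hY with hY | hY | hY
  · exact ⟨b.src, hY.symm, by nlinarith [h0, Nat.zero_le ((P.d + 1) * P.L ^ k)]⟩
  · -- `Y = B(b₋) − e_μ`: witness = the corner of `Y`; the corner of `Y + e_μ = B(b₋)` is `L^k` away
    refine ⟨(Site.fibreSite 0 k (Y) fun _ => (⟨0, pow_pos P.L_pos k⟩ : Fin (P.L ^ k))), hcorner Y, ?_⟩
    have h1 : Site.tdist c (Site.fibreSite 0 k (Y.shift b.dir) fun _ => (⟨0, pow_pos P.L_pos k⟩ : Fin (P.L ^ k))) ≤ R₀ + P.d * (P.L ^ k - 1) := by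
      rw [hY]; exact (tdist_triangle c b.src _).trans (Nat.add_le_add h0 hblk)
    have h2 : Site.tdist (Site.fibreSite 0 k (Y.shift b.dir) fun _ => (⟨0, pow_pos P.L_pos k⟩ : Fin (P.L ^ k))) (Site.fibreSite 0 k (Y) fun _ => (⟨0, pow_pos P.L_pos k⟩ : Fin (P.L ^ k))) ≤ P.L ^ k := by rw [tdist_comm]; exact hadj Y b.dir
    have := (tdist_triangle c (Site.fibreSite 0 k (Y.shift b.dir) fun _ => (⟨0, pow_pos P.L_pos k⟩ : Fin (P.L ^ k))) (Site.fibreSite 0 k (Y) fun _ => (⟨0, pow_pos P.L_pos k⟩ : Fin (P.L ^ k)))).trans (Nat.add_le_add h1 h2)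
    nlinarith [this, hdk]
  · -- `Y = B(b₋) + e_μ`: witness = the corner of `Y`
    refine ⟨(Site.fibreSite 0 k (Y) fun _ => (⟨0, pow_pos P.L_pos k⟩ : Fin (P.L ^ k))), hcorner Y, ?_⟩
    have h1 : Site.tdist c (Site.fibreSite 0 k (iterBlockOf k b.src) fun _ => (⟨0, pow_pos P.L_pos k⟩ : Fin (P.L ^ k))) ≤ R₀ + P.d * (P.L ^ k - 1) :=
      (tdist_triangle c b.src _).trans (Nat.add_le_add h0 hblk)
    have h2 := hadj (iterBlockOf k b.src) b.dir
    rw [← hY] at h2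
    have := (tdist_triangle c (Site.fibreSite 0 k (iterBlockOf k b.src) fun _ => (⟨0, pow_pos P.L_pos k⟩ : Fin (P.L ^ k))) (Site.fibreSite 0 k (Y) fun _ => (⟨0, pow_pos P.L_pos k⟩ : Fin (P.L ^ k)))).trans (Nat.add_le_add h1 h2)
    nlinarith [this, hdk]

end Support

/-! ## §4 ★★★ At the member: the discharged (L5) gauge rows for the cube gauge `σ_c = axialT U₀ c` -/

section Member

variable (F : T3Family) (n K : ℕ) (h : n ≤ K) (c₀ cB : ℝ) [Fact (0 < c₀)] [Fact (0 < cB)]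

/-- **px17's cut-off support clause in the `tdist` letter**: `χ c x ≠ 0 → ∀ κ, min (x κ − c κ).val (c κ − x κ).val < L^sℓ` (✓`Prop7LODCutoffDock.exists_LOD_cutoffs_corner`, conjunct 5)
gives `(χ_c•A) b ≠ 0 → tdist(c, b₋) ≤ 3·L^sℓ` — the support radius `R₀` of §3∕§4 for the field `X := χ_c•A`. [cite: Balaban1985BackgroundPropagators, (3.100) pp.413-414] -/
theorem tdist_le_of_hsupp (s : ℕ) (χ : Site (F.P K) 0 → Site (F.P K) 0 → ℝ)
    (hsupp : ∀ c x, χ c x ≠ 0 → ∀ κ : Fin 3, min (x κ - c κ).val (c κ - x κ).val < F.L ^ s * F.L ^ (K - n))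
    (c : Site (F.P K) 0) (A : PBond (F.P K) 0 → Matrix (Fin 2) (Fin 2) ℂ) :
    ∀ b : PBond (F.P K) 0, (fun b' : PBond (F.P K) 0 => χ c b'.src • A b') b ≠ 0 → Site.tdist c b.src ≤ 3 * (F.L ^ s * F.L ^ (K - n)) := by
  intro b hb
  have hχ : χ c b.src ≠ 0 := by
    intro h0; apply hb; simp only [h0, zero_smul]
  have hκ := hsupp c b.src hχ
  have hd : (F.P K).d = 3 := T3Family.P_d F K
  unfold Site.tdist
  calc ∑ κ : Fin (F.P K).d, min (c κ - b.src κ).val (b.src κ - c κ).val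
      ≤ ∑ _κ : Fin (F.P K).d, F.L ^ s * F.L ^ (K - n) := Finset.sum_le_sum fun κ _ => by rw [min_comm]; exact (hκ κ).le
    _ = 3 * (F.L ^ s * F.L ^ (K - n)) := by rw [Finset.sum_const, Finset.card_univ, Fintype.card_fin, hd, smul_eq_mul]

set_option maxHeartbeats 400000 in
/-- ★★★ **THE (L5c) THIRD, FULLY DISCHARGED FROM `RegPr` WITH THE CUBE GAUGE `σ_c := axialT U₀ c`.**  `RegPr F n K ε₀ U₀`, `10¹⁰L⁶ε₀ ≤ 1`, `10¹²L³ε₀ ≤ 1`; a centre `c`; a field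
`A` supported within torus distance `R₀` of `c` (`A b ≠ 0 → tdist(c, b₋) ≤ R₀`; px17's cut-offs: `R₀ = 3L^sℓ`); no wrap: `2(R₀ + 8ℓ + 1) ≤ sitesPerDir 0` (`ℓ = L^{K−n}`).  Then with
`δ_c := 2·regThreshold F n K ε₀·(R₀ + 7ℓ)` and every `θ > 0`:
`‖Q_k(1)(Ad_{σ_c}A)~‖² ≤ (1+θ)·‖Q_k(U₀)Ã‖² + (1+θ⁻¹)·4·(3·10¹⁰L¹⁰ε₀² + 192(ℓδ_c)²)·(cB∕(c₀ℓ^d))·‖Ã‖²` — ✓`normSq_Qk_one_conj_le_of_blockSet` at `S := S_c(R₀ + 4ℓ)` with §2∕§3.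
[cite: Balaban1985BackgroundPropagators, (3.13)-(3.16) p.393, Thm 3.11 p.416; Balaban1985RegularSpaces, Lemma 1 (1.25) p.79; Balaban1984PropagatorsI, (1.18) p.20] -/
theorem normSq_Qk_one_conj_le_cubeGauge {ε₀ : ℝ} (hε₀ : 0 < ε₀) (hε : 10 ^ 10 * (F.L : ℝ) ^ 6 * ε₀ ≤ 1) (hε12 : 10 ^ 12 * (F.L : ℝ) ^ 3 * ε₀ ≤ 1)
    (W : GaugeField (F.P K) 0 (Matrix.specialUnitaryGroup (Fin 2) ℂ)) (hreg : RegPr F n K ε₀ W) (c : Site (F.P K) 0)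
    (A : PBond (F.P K) 0 → Matrix (Fin 2) (Fin 2) ℂ) {R₀ : ℕ} (hA : ∀ b, A b ≠ 0 → Site.tdist c b.src ≤ R₀)
    (hwrap : 2 * (R₀ + 8 * (F.P K).L ^ (K - n) + 1) ≤ (F.P K).sitesPerDir 0) {θ : ℝ} (hθ : 0 < θ) :
    ‖Qk F n K h c₀ cB (1 : GaugeField (F.P K) 0 (Matrix.specialUnitaryGroup (Fin 2) ℂ)) (toL2 F K c₀ (fun b => ((axialT W c b.src : Matrix.specialUnitaryGroup (Fin 2) ℂ) : Matrix (Fin 2) (Fin 2) ℂ) * A b * star ((axialT W c b.src : Matrix.specialUnitaryGroup (Fin 2) ℂ) : Matrix (Fin 2) (Fin 2) ℂ)))‖ ^ 2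
      ≤ (1 + θ) * ‖Qk F n K h c₀ cB W (toL2 F K c₀ A)‖ ^ 2
        + (1 + θ⁻¹) * (4 * (3 * 10 ^ 10 * (F.L : ℝ) ^ 10 * ε₀ ^ 2 + 192 * ((F.L : ℝ) ^ (K - n) * (2 * regThreshold F n K ε₀ * ((R₀ : ℝ) + 7 * (F.L : ℝ) ^ (K - n)))) ^ 2)
            * (cB / (c₀ * ((F.L : ℝ) ^ (K - n)) ^ (F.P K).d))) * ‖toL2 F K c₀ A‖ ^ 2 := by
  have hk : K - n ≤ (F.P K).m + (F.P K).K := by show K - n ≤ F.m + K; omega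
  have hd : (F.P K).d = 3 := T3Family.P_d F K
  have hLL : ((F.P K).L : ℝ) = F.L := rfl
  have ha₀ := regThreshold_pos F (n := n) (K := K) hε₀
  have hU := hreg.plaqSmall
  have hL1 : (1 : ℝ) ≤ (F.L : ℝ) ^ (K - n) := by
    have h3 : 3 ≤ F.L := by obtain ⟨a, ha⟩ := F.hL.1; have := F.hL.2; omega
    have : (1 : ℝ) ≤ F.L := by exact_mod_cast (le_trans (by norm_num) h3)
    exact one_le_pow₀ this
  -- the block set of radius `R₀ + 4ℓ` and its flatness `δ_c`
  have hwrapR : 2 * ((R₀ + ((F.P K).d + 1) * (F.P K).L ^ (K - n)) + (F.P K).d * (F.P K).L ^ (K - n) + 1) ≤ (F.P K).sitesPerDir 0 := by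
    rw [hd]; omega
  have hax := norm_gaugeAct_axialT_sub_one_le_of_mem_blockSet hk W ha₀ hU c hwrapR
  have hS := hS_of_tdist hk c A hA
  have hδ : 0 ≤ 2 * regThreshold F n K ε₀ * ((R₀ : ℝ) + 7 * (F.L : ℝ) ^ (K - n)) := by positivity
  -- monotonicity: `2a₀(R₀ + 4ℓ + 3(ℓ − 1)) ≤ 2a₀(R₀ + 7ℓ)`
  have hmono : 2 * regThreshold F n K ε₀ * ((((R₀ + ((F.P K).d + 1) * (F.P K).L ^ (K - n) : ℕ)) : ℝ) + ((F.P K).d : ℝ) * ((((F.P K).L : ℝ)) ^ (K - n) - 1))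
      ≤ 2 * regThreshold F n K ε₀ * ((R₀ : ℝ) + 7 * (F.L : ℝ) ^ (K - n)) := by
    rw [hd]; push_cast; simp only [hLL]
    nlinarith [ha₀.le, hL1]
  have hax' : ∀ b : PBond (F.P K) 0, iterBlockOf (K - n) b.src ∈ {Y : Site (F.P K) (K - n) | ∃ x : Site (F.P K) 0, iterBlockOf (K - n) x = Y ∧ Site.tdist c x ≤ R₀ + ((F.P K).d + 1) * (F.P K).L ^ (K - n)} →
      iterBlockOf (K - n) b.tgt ∈ {Y : Site (F.P K) (K - n) | ∃ x : Site (F.P K) 0, iterBlockOf (K - n) x = Y ∧ Site.tdist c x ≤ R₀ + ((F.P K).d + 1) * (F.P K).L ^ (K - n)} →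
      ‖((GaugeField.gaugeAct (axialT W c) W b : Matrix.specialUnitaryGroup (Fin 2) ℂ) : Matrix (Fin 2) (Fin 2) ℂ) - 1‖ ≤ 2 * regThreshold F n K ε₀ * ((R₀ : ℝ) + 7 * (F.L : ℝ) ^ (K - n)) :=
    fun b hb hb' => (hax b hb hb').trans hmono
  exact normSq_Qk_one_conj_le_of_blockSet F n K h c₀ cB hε₀ hε hε12 W hreg (axialT W c) hδ A _ hax' hS hθ

/-- ★★ The matching (L5b) row `hVbond` with the SAME `δ_c = 2·regThreshold·(R₀ + 7ℓ)`. [cite: Balaban1985RegularSpaces, Lemma 1 (1.25) p.79] -/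
theorem hVbond_cubeGauge {ε₀ : ℝ} (hε₀ : 0 < ε₀) (W : GaugeField (F.P K) 0 (Matrix.specialUnitaryGroup (Fin 2) ℂ)) (hreg : RegPr F n K ε₀ W) (c : Site (F.P K) 0)
    (A : PBond (F.P K) 0 → Matrix (Fin 2) (Fin 2) ℂ) {R₀ : ℕ} (hA : ∀ b, A b ≠ 0 → Site.tdist c b.src ≤ R₀)
    (hwrap : 2 * (R₀ + 8 * (F.P K).L ^ (K - n) + 1) ≤ (F.P K).sitesPerDir 0) :
    ∀ b : PBond (F.P K) 0, A b ≠ 0 → ‖((GaugeField.gaugeAct (axialT W c) W b : Matrix.specialUnitaryGroup (Fin 2) ℂ) : Matrix (Fin 2) (Fin 2) ℂ) - 1‖ ≤ 2 * regThreshold F n K ε₀ * ((R₀ : ℝ) + 7 * (F.L : ℝ) ^ (K - n)) := by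
  intro b hb
  have ha₀ := regThreshold_pos F (n := n) (K := K) hε₀
  have h1 := hVbond_of_tdist W ha₀ hreg.plaqSmall c A hA (by omega) b hb
  have hL0 : (0 : ℝ) ≤ (F.L : ℝ) ^ (K - n) := by positivity
  nlinarith [ha₀.le, hL0]

/-- ★★ The matching (L5a) row `hVplaq` with the SAME `δ_c`. [cite: Balaban1985RegularSpaces, Lemma 1 (1.25) p.79] -/
theorem hVplaq_cubeGauge {ε₀ : ℝ} (hε₀ : 0 < ε₀) (W : GaugeField (F.P K) 0 (Matrix.specialUnitaryGroup (Fin 2) ℂ)) (hreg : RegPr F n K ε₀ W) (c : Site (F.P K) 0)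
    (A : PBond (F.P K) 0 → Matrix (Fin 2) (Fin 2) ℂ) {R₀ : ℕ} (hA : ∀ b, A b ≠ 0 → Site.tdist c b.src ≤ R₀)
    (hwrap : 2 * (R₀ + 8 * (F.P K).L ^ (K - n) + 1) ≤ (F.P K).sitesPerDir 0) :
    ∀ (x : Site (F.P K) 0) (μ ν : Fin (F.P K).d), μ ≠ ν → A ⟨x.shift μ, ν⟩ ≠ 0 →
      ‖((GaugeField.gaugeAct (axialT W c) W ⟨x, μ⟩ : Matrix.specialUnitaryGroup (Fin 2) ℂ) : Matrix (Fin 2) (Fin 2) ℂ) - 1‖ ≤ 2 * regThreshold F n K ε₀ * ((R₀ : ℝ) + 7 * (F.L : ℝ) ^ (K - n)) := by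
  intro x μ ν hμν hne
  have ha₀ := regThreshold_pos F (n := n) (K := K) hε₀
  have hL1 : 1 ≤ (F.P K).L ^ (K - n) := Nat.one_le_pow _ _ (F.P K).L_pos
  have h1 := hVplaq_of_tdist W ha₀ hreg.plaqSmall c A hA (by omega) x μ ν hμν hne
  have hL1' : (1 : ℝ) ≤ (F.L : ℝ) ^ (K - n) := by
    have h3 : 3 ≤ F.L := by obtain ⟨a, ha⟩ := F.hL.1; have := F.hL.2; omega
    have : (1 : ℝ) ≤ F.L := by exact_mod_cast (le_trans (by norm_num) h3)
    exact one_le_pow₀ this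
  nlinarith [ha₀.le, hL1']

end Member

end Summit.QuantumFields.YangMills.Theorems.Prop7LODCubeGaugeFamily

end
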